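import Mathlib
import HarnessLib
import HarnessLib.Audit
import Summits.RiemannHypothesis.Statement
import Literature.NumberTheory.LFunctions.RiemannXi
import HarnessLib.Audit.Status.Attr

/-!
Route: AngularHeatFlow

DORMANT since 2026-08-24T01:13:00Z (reconciler: no traction for 6.4 d (last activity item-evidence-added at 2026-08-17T14:53:52Z); parked, not closed — `ledger route dormant route-RiemannHypothesis-AngularHeatFlow --off` to reactivate) — unstaffed, not closed; items shared with open routes are served there. `ledger route dormant <id> --off` reactivates.

# Route AngularHeatFlow — the multiplicative de Bruijn–Newman constant: Gaussian heat flow in the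
angular variable at the centre of ξ

**Thesis X (words).** Let G(z) = Σ_n a_n zⁿ with a_n = γ(n)/(8·n!), γ(n) =
`Literature.NumberTheory.LFunctions.xiTaylorCoeff n` (GORZ Taylor coefficients; a_n > 0; G(w²) =
ξ(1/2+w), i.e. G = `Literature.NumberTheory.LFunctions.xiSq` and a_n = `xiSqCoeff n` definitionally;
zeros z_ρ = (ρ−1/2)²). For c ≥ 0 put T_c G(z) := Σ_n e^{−c n²} a_n zⁿ = exp(−c (z d/dz)²) G — the
heat flow in the angular variable v = log(−z) (de Bruijn's e^{−c∂_v²} applied to the 2πi-periodic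
F(v) = G(−e^v)), equivalently the Gaussian rotation average E[G(z e^{i√(2c)N})]. X: for every c > 0,
T_c G has only real zeros (i.e. the threshold Λ_× := inf{c ≥ 0 : T_c G hyperbolic} is 0). X realises
card angular-heat-flow-multiplicative-dbn; X = AhfHighReal ∧ AhfLowReal (split at radius 4/c).

Lean: `∀ c : ℝ, 0 < c → ∀ z : ℂ, (∑' n : ℕ, (Real.exp (-(c * (n : ℝ) ^ 2)) : ℂ) *
((Literature.NumberTheory.LFunctions.xiTaylorCoeff n : ℂ) / (8 * (n.factorial : ℂ))) * z ^ n) = 0 →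
z.im = 0`

**Assembly.** X → Summit.RiemannHypothesis is the item `Assembly` (provable now): T_c G → G locally
uniformly as c → 0⁺ (termwise domination by Σ a_n |z|ⁿ < ∞, `xiSq_radius_eq_top`), G ≢ 0
(`xiSq_zero_ne`), Hurwitz (`Literature.Analysis.Complex.Hurwitz`) ⇒ every zero of G is a limit of
zeros of the T_c G, hence real; a_n > 0 (`xiTaylorCoeff_pos_holds`) ⇒ real zeros are negative;
`xiSq_zeros_iff_riemannHypothesis` (proved) ⇒ RH. Conversely RH → X is the item `AhfConverse`
(Pólya–Schur/Laguerre: {e^{−cn²}} is a multiplier sequence), so X is exactly RH-strength. Deciding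
theorem `closes` (certified, sorry-free): `Assembly` applied to the case split `le_or_gt (4/c) ‖z‖`
between `AhfHighReal` and `AhfLowReal`. Spelling (rev 2): every item is stated over `xiTaylorCoeff`
(module `Literature.NumberTheory.LFunctions.RiemannXi`, Mathlib-only imports, no unproved named fact
in its cone); the rev-1 items over `xiSqCoeff` are the same propositions by `Iff.rfl` (checked), so
provers may `import Literature.NumberTheory.LFunctions.ZetaLogDerivSeries` and rewrite with
`xiSqCoeff`/`xiSq` freely inside Theorems files.

Rationale: WHY THIS LINE. Card RiemannHypothesis/RiemannHypothesis/angular-heat-flow-multiplicative-dbn; it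
imports Laguerre–Pólya / multiplier-sequence theory (CZDS, Hutchinson and Katkova–Lobova–Vishnyakova
constants), parabolic heat flow and Jacobi theta functions into the zero theory of ξ. Of the three
Gaussian flows canonically attached to ξ at its centre (de Bruijn's in t: repair cost δ², Λ = 0
exactly, 'barely true' [arXiv:1801.05914]; in z = t²: cost δ²γ², robustly true; in log z: cost
δ²/γ²), the angular one is MONOTONE (Laguerre/Craven–Csordas: {e^{−cn²}} is a
complex-zero-decreasing multiplier sequence, so the non-real count N(c) is non-increasing and Λ_× is
a threshold), ONE-SIDED (c < 0 diverges: ξ sits at the edge of the semigroup, no Newman side) and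
has an UNCONDITIONAL first rung Λ_× ≤ log 2 (PF₂ of (a_n) from the Csordas–Norfolk–Varga Turán
inequalities / Katkova PF₄₉ in tree, + Hutchinson's theorem; doi:10.1007/bf03321047 and
arXiv:1903.09070 suggest the sharper ½log q_∞ = 0.587). The cost law is stated, not hidden: an
off-line zero (δ, γ) is repaired once c ≳ 2δ²/γ², so Λ_× ≤ c is 'RH to height ≍ c^{−1/2}' PLUS a
theorem that nothing non-real survives above — and that theorem (localised de Bruijn strip-narrowing
for an INFINITE-ORDER periodic exponential sum, after Ki–Kim–Lee doi:10.1016/j.aim.2009.04.003 and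
Polymath15 arXiv:1904.12438 for the additive flow) is new complex analysis with an engine.

RANKED CRUXES.
- #2 AhfHighReal (crux): ∀ c > 0, zeros of T_c G with ‖z‖ ≥ 4/c are real — the localised de Bruijn
theorem specialised to ξ via the unconditional sector |arg(−z_ρ)| ≤ 2δ/γ ≲ ‖z_ρ‖^{−1/2}; radius 4/c
is a factor 8 above the heuristic flow time ‖z‖ ≥ 1/(2c) (why it might fail: the constant — the
additive analogue is known only beyond exp(C/t), arXiv:1904.12438 Thm 1.5(i); de Bruijn's Thm 13 is
global and needs order < 2).
- #4 AhfLowReal (crux): zeros with ‖z‖ < 4/c are real — RH-strength as c → 0⁺ (honest residue); for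
c ≥ c₀ it is RH-to-height 2/√c₀ transported along the monotone flow (why it might fail: false iff RH
fails; as a target it is RH in the limit — PlattTrudgian2021,
Literature.Barriers.RiemannHypothesis.JensenPolynomials).
- Support (not staffing-driving): AhfTailFinite (rank 3: ∀ c > 0 ∃ R, zeros beyond R real — per-c
finiteness, the formal base of #2; engine: localisation of the tapered coefficients to the two-sided
Jacobi theta Σ q^{m²}yᵐ, all zeros real by the triple product), AhfRungZero (c ≥ log 2, provable
now), AhfMonotone (Pólya–Schur, provable now), AhfConverse (RH → X, calibration), AhfThesis (target,
rank 0: X itself), Assembly (X → RH by Hurwitz, provable now).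

TWO-LAYER PLAN. The glue is propositional and certified: closes = Assembly ∘ (AhfHighReal,
AhfLowReal split by le_or_gt (4/c) ‖z‖); also AhfHighReal → AhfTailFinite with R := 4/c
(Sketch.lean). Foreseen glued split, filed only after AhfTailFinite lands: AhfHighReal ⇐
TailBeyond(R(c)) → AnnulusCount(4/c ≤ ‖z‖ ≤ R(c), argument principle transported along AhfMonotone)
→ AhfHighReal, k = 2.

KILL CRITERIA. (i) A certified non-real zero of some T_c G, c > 0, refutes X and RH (no cheaper than
direct verification, by the cost law). (ii) #2 refuted with radius 4/c but true with exp(C/c):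
restate (threshold error, not a kill); #2 false for every radius function ⇒ infinitely many non-real
zeros for some c > 0 ⇒ ¬RH. (iii) Close as reformulation (superseded by DBN/TotalPositivity) if,
after #2/AhfTailFinite land, refuters show every route to #4 inputs RH-to-height verbatim with no
flow-side gain; #2/AhfTailFinite then migrate to Literature as theorems.

NOT DECOMPOSED YET. No general (non-ξ) localised de Bruijn statement, no exchange-rate items (TP_r ⇒
threshold c_r < log 2; Hardy–Petrovitch–Hutchinson problem), no rigidity item ('the only diagonal
L-P-preserving semigroups are generated by n, n²'), no certified N(c) maps (kit), no Λ_sq /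
hyperbolic-tube statement; no definition `taperedXiSq` requested — the statements inline the tsum
over xiTaylorCoeff so that the route file imports only Literature.NumberTheory.LFunctions.RiemannXi
(rev 2 drops Literature.NumberTheory.LFunctions.ZetaLogDerivSeries, whose chain LevinsonMontgomery →
RHClassicalEquivalents → RHWave0 dragged nine unproved named facts — LindelofHypothesis,
GeneralizedRiemannHypothesis, platt_trudgian_numerical_rh, SimpleZerosConjecture,
bourgain_subconvexity, the two zero-free regions, NoSiegelZeros, deuring_heilbronn — into the cone
although no item uses any of them; needs-fact: none).

CHEAPEST FALSIFIER. X ↔ RH (AhfConverse / Assembly), so no zero search falsifies X, #2, #4 or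
AhfTailFinite short of a counterexample to RH; the cheapest kill is on the MECHANISM that makes #2
more than RH-to-height, and it is one kit job (mpmath, minutes): take a truncation G_N(z) = Σ_{n≤N}
a_n zⁿ (a_n = 2∫₀^∞ Φ(u)u^{2n}du/(2n)! from Riemann's Φ at 50 digits; N such that the tail is below
precision on ‖z‖ ≤ 2·10³), displace one conjugate pair of its zeros off the negative axis inside the
unconditional sector at ‖z‖ ≈ 900 (γ ≈ 30, δ = 0.4, so |Im v| = 2δ/γ ≈ 0.027), apply T_c with c =
4/900 (the pair then sits exactly at radius 4/c) and read off whether the pair has become real. de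
Bruijn's isolated-pair time is (Im v)²/2 ≈ 3.6·10⁻⁴, a factor 12 below c; if the pair is still
non-real at c = 4/900 the factor-8 margin of #2 is illusory at ξ's actual zero density and #2 must
be restated with a larger radius before any prover time is spent (kill (ii), first branch); if it is
real with room to spare the constant 4 is corroborated (not proved).

Novelty: NOVELTY (searched 2026-08-15 before claiming: lit search --source zbmath "Riemann xi function
multiplier sequence real zeros" (4 rows: Csordas 2003 zbl:1070.11039 CZDS-and-RH II; Kuznetsov 2008;
Wagner 2022 arXiv:2108.01827), "partial theta function Laguerre-Polya second quotients"
(Nguyen–Vishnyakova 2021 doi:10.30970/ms.56.2.149-161), "Katkova Lobova Vishnyakova power series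
sections" (doi:10.1007/bf03321047); lit galaxy search --star all "complex zero decreasing sequences"
(ISAAC 2001 volume = Csordas; arXiv:1903.09070 Nguyen–Vishnyakova READ p.1; Brändén–Chasse
arXiv:1402.2795); lit frontier RiemannHypothesis --since 2023 (nothing on tapered/angular flows);
searchd local index rc 75 all session; plus the card's own searches and two refuter audits (grade
new-combination, 2026-08-15T09:33Z)).
Nearest prior art: (1) Csordas 2003/2007 (zbl:1070.11039, zbl:1147.30019): CZDS / multiplier
operators applied to ξ as NECESSARY conditions — no threshold constant, no diagonal Gaussian
semigroup, no rung; (2) the de Bruijn–Newman literature in the additive variable t: Rodgers–Tao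
arXiv:1801.05914 (Λ ≥ 0), Ki–Kim–Lee doi:10.1016/j.aim.2009.04.003 (per-t finiteness), Polymath15
arXiv:1904.12438, Platt–Trudgian 2021 (Λ ≤ 0.2); (3) the Jensen/Turán line GORZ arXiv:1902.07321,
Farmer arXiv:2008.07206 (the binomial taper J^{d,0} is the truncated shadow of T_{1/2d}); (4)
Hutchinson/KLV/Nguyen–Vishnyakova second-quotient theory (doi:10.1007/bf03321047, arXiv:1903.09070)
for the rung constants  [refs: 10.30970/ms.56.2.149-161, 10.1007/bf03321047, 10.1016/j.aim.2009.04.003, 2108.01827, 1903.09070, 1402.2795, 1801.05914, 1904.12438, 1902.07321, 2008.07206, doi:10.30970/ms.56.2.149-161, doi:10.1007/bf03321047, doi:10.1016/j.aim.2009.04.003]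

Barriers (technique_class: Laguerre-Polya multiplier-semigroup hyperbolicity heat-flow): BARRIERS (technique_class: Laguerre-Polya multiplier-semigroup hyperbolicity heat-flow; catalogue
Literature/Barriers/RiemannHypothesis read: JensenPolynomials, NewmanConjecture, DavenportHeilbronn,
DeBrangesPositivity, LindelofBacklund + index of the other 18).
- Literature.Barriers.RiemannHypothesis.JensenPolynomials (Farmer 2022; proved in tree with witness
(1+z²)eᶻ): bars inferences from LARGE-SHIFT hyperbolicity (n → ∞ at fixed degree). Our parameter
runs along the degree/taper direction at shift 0 (T_{1/2d} ≈ smoothed J^{d,0}), which is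
RH-equivalent, so the theorem does not apply; its MORAL (Chasse: shift-0 data of order d sees height
√d only) does, and the route states the quantitative version itself — a rung Λ_× ≤ c certifies
nothing above height ≍ c^{−1/2}. Not evaded; the bet is on #2/#3 as theorems (flow-side content:
nothing non-real survives ABOVE the certified height, which numerics alone never give) and on #4
being attacked through the monotone structure rather than rung by rung.
- Literature.Barriers.RiemannHypothesis.NewmanConjecture (Rodgers–Tao Λ ≥ 0; ¬DeBruijnRoute): not
applicable by construction — different semigroup (dilations about s = 1/2, not translations in t),
and NO negative-parameter side exists (e^{|c|n²}a_n diverges), so 'RH with room to spare' cannot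
even be formulated here; recorded as the contrast, not claimed as an evasion of the t-flow barrier.
- Literature.Barriers.RiemannHypothesis.DavenportHeilbronn: the central Taylor data encode Eule

History (route lifecycle, newest last):
- 2026-08-15T16:18:03Z · rev 2: restated AhfThesis (stmt-RiemannHypothesis-1002), AhfHighReal (stmt-RiemannHypothesis-1003), AhfLowReal (stmt-RiemannHypothesis-1005), AhfTailFinite (stmt-RiemannHypothesis-1004), AhfRungZero (stmt-RiemannHypothesis-1006), AhfMonotone (stmt-RiemannHypothesis-1007), AhfConverse (stmt-RiemannHypothesis-1008), Asse (planner-rbadge-RiemannHypothesis-AngularHeatFl-eb57c1f4-g2-0)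
- 2026-08-16T04:16:17Z · AUTO-CRUX (backfill): AhfThesis — hypotheses of the deciding theorem that nothing in the route derives are cruxes (operator:999:1085951)
- 2026-08-24T01:13:00Z · DORMANT — reconciler: no traction for 6.4 d (last activity item-evidence-added at 2026-08-17T14:53:52Z); parked, not closed — `ledger route dormant route-RiemannHypothesi (operator:999:782745)

sub-problem: RiemannHypothesis · status: dormant · opened planner-plancards-RiemannHypothesis-RiemannHypothesis-20260815w1-2-0 2026-08-15T10:39:12Z · rev 2 · ledger route-RiemannHypothesis-AngularHeatFlow
GENERATED by the gate from the ledger (D-0016/17). Provers cite these decls: `theorem foo : Summit.RiemannHypothesis.RiemannHypothesis.Theses.AngularHeatFlow.<Decl> := …` in Summits/RiemannHypothesis/RiemannHypothesis/Theorems/<Name>.lean.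
-/

namespace Summit.RiemannHypothesis.RiemannHypothesis.Theses.AngularHeatFlow

open scoped BigOperators Topology Manifold Classical MeasureTheory ProbabilityTheory Matrix InnerProductSpace ComplexConjugate ContinuousMap
open Filter Set Function TopologicalSpace MeasureTheory

attribute [summit_statement] _root_.Summit.RiemannHypothesis

open Summit

-- earlier AhfThesis (stmt-RiemannHypothesis-1002, replaced 2026-08-15T16:18:03Z -> stmt-RiemannHypothesis-10531): retired by None — ∀ c : ℝ, 0 < c → ∀ z : ℂ, (∑' n : ℕ, (Real.exp (-(c * (n : ℝ) ^ 2)) : ℂ) * Literature.NumberTheory.LFunctions.xiSqCoeff n * z ^ n) = 0 → z.im = 0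
/-- item stmt-RiemannHypothesis-10531 · crux (kind.auto-crux: conjecture-grade) · rank 0 · open · by planner
why it might fail: X ↔ RH (← Pólya–Schur/Gaussian multiplier sequence, → Hurwitz), so X is false iff RH is. As a target no c-uniform mechanism exists: a rung Λ_×≤c is RH to height ≍c^{-1/2} plus a tail theorem (JensenPolynomials/Chasse moral); the c→0⁺ limit is RH itself.
sources: Literature.NumberTheory.LFunctions.xiSq_zeros_iff_riemannHypothesis, Literature.Barriers.RiemannHypothesis.JensenPolynomials, Farmer2022 §4, Chasse2013, arXiv:1801.05914, zbl:1070.11039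
[target] Thesis X of route AngularHeatFlow: for every c > 0 the Gaussian-tapered series T_c G(z) =
Σ_n e^{−c n²} a_n zⁿ, a_n = γ(n)/(8·n!) = (xiTaylorCoeff n)/(8·n!) (= xiSqCoeff n definitionally; G
= xiSq, G(w²) = ξ(1/2+w)), has only real zeros; equivalently the multiplicative de Bruijn–Newman
constant Λ_× = inf{c ≥ 0 : T_c G hyperbolic} is 0. RH ↔ X (→ Pólya–Schur with the Gaussian
multiplier sequence, item AhfConverse; ← Hurwitz, item Assembly). T_c = exp(−c(z d/dz)²) = de
Bruijn's e^{−c∂_v²} in v = log(−z): heat flow in the angular variable about s = 1/2. Rev 2: restated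
over xiTaylorCoeff (module RiemannXi, fact-free cone); Iff.rfl-equal to the rev-1 statement over
xiSqCoeff [card angular-heat-flow-multiplicative-dbn; Csordas 2003 zbl:1070.11039;
arXiv:1801.05914]. -/
@[route_item "route-RiemannHypothesis-AngularHeatFlow", crux]
def AhfThesis : Prop :=
  ∀ c : ℝ, 0 < c → ∀ z : ℂ, (∑' n : ℕ, (Real.exp (-(c * (n : ℝ) ^ 2)) : ℂ) * ((Literature.NumberTheory.LFunctions.xiTaylorCoeff n : ℂ) / (8 * (n.factorial : ℂ))) * z ^ n) = 0 → z.im = 0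

-- earlier AhfHighReal (stmt-RiemannHypothesis-1003, replaced 2026-08-15T16:18:03Z -> stmt-RiemannHypothesis-10532): retired by None — ∀ c : ℝ, 0 < c → ∀ z : ℂ, (∑' n : ℕ, (Real.exp (-(c * (n : ℝ) ^ 2)) : ℂ) * Literature.NumberTheory.LFunctions.xiSqCoeff n * z ^ n) = 0 → 4 / c ≤ ‖z‖ → z.im = 0
/-- item stmt-RiemannHypothesis-10532 · crux · rank 2 · open · by planner
why it might fail: RH-implied: false only under ¬RH. Risk = the constant 4: for c ≳ 10⁻³, 4/c is below the saddle-dominance radius of the arc average E[ξ(½+ixe^{iθ/2})]; the additive analogue holds only for x ≥ exp(C/t) (Polymath15 Thm 1.5(i)); de Bruijn's Thm 13 is global (order < 2), no local version is known.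
sources: arXiv:1904.12438 Thm 1.5(i) (zeros of H_t with x ≥ exp(C/t) are real; KKL constants ineffective), KiKimLee2009 (doi:10.1016/j.aim.2009.04.003; paywalled, acq-00145), Bruijn1950 Thm 13 (Duke Math. J. 17: global strip, order < 2), Chasse2013 / Literature.Barriers.RiemannHypothesis.xiSq_zeros_mem_sector, Literature.NumberTheory.LFunctions.xiSq_zeros_mem_negCone
[crux] LOCALISED DE BRUIJN (crux #2): for every c > 0, every zero of T_c G (a_n = (xiTaylorCoeff
n)/(8·n!) = xiSqCoeff n) with ‖z‖ ≥ 4/c is real. In v = log(−z) the function F(v) = G(−e^v) =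
Σ(−1)ⁿa_n e^{nv} is entire, 2πi-periodic, of INFINITE order, and T_c = e^{−c∂_v²}; unconditionally
the zeros z_ρ = (ρ−1/2)² satisfy |Im z_ρ| = 2|β−1/2||γ| ≤ |γ| ≍ |z_ρ|^{1/2}, so |Im v − π| ≲
|z|^{−1/2} (mod 2π) beyond radius |z|: de Bruijn's strip-narrowing (Bruijn1950 Thm 13: zeros in |Im|
≤ Δ ⇒ real after time Δ²/2), REDONE LOCALLY for this infinite-order periodic sum, gives reality
beyond radius ≍ 1/(2c); 4/c carries a factor-8 margin. Unconditional theorem target; with γ₁ = 14.13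
alone it yields Λ_× ≲ 3·10⁻³, with Platt–Trudgian (RH to 3·10¹²) Λ_× ≲ 10⁻²⁵. Engine: heat-kernel
localisation in v + de Bruijn convexity; cf. Ki–Kim–Lee 2009 for the t-flow analogue. Rev 2:
restated over xiTaylorCoeff, Iff.rfl-equal to rev 1. [deps: AhfTailFinite] [difficulty: XL] -/
@[route_item "route-RiemannHypothesis-AngularHeatFlow", crux]
def AhfHighReal : Prop :=
  ∀ c : ℝ, 0 < c → ∀ z : ℂ, (∑' n : ℕ, (Real.exp (-(c * (n : ℝ) ^ 2)) : ℂ) * ((Literature.NumberTheory.LFunctions.xiTaylorCoeff n : ℂ) / (8 * (n.factorial : ℂ))) * z ^ n) = 0 → 4 / c ≤ ‖z‖ → z.im = 0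

-- earlier AhfLowReal (stmt-RiemannHypothesis-1005, replaced 2026-08-15T16:18:03Z -> stmt-RiemannHypothesis-10533): retired by None — ∀ c : ℝ, 0 < c → ∀ z : ℂ, (∑' n : ℕ, (Real.exp (-(c * (n : ℝ) ^ 2)) : ℂ) * Literature.NumberTheory.LFunctions.xiSqCoeff n * z ^ n) = 0 → ‖z‖ < 4 / c → z.im = 0
/-- item stmt-RiemannHypothesis-10533 · crux · rank 4 · open · by planner
why it might fail: False iff RH fails: an off-line zero ½+δ+iγ keeps a non-real pair of T_cG near |z|≈γ² for c ≲ 2δ²/γ², inside the disc. As a target it is RH-strength uniformly in c (disc exhausts ℂ as c→0⁺); for c ≥ c₀ it is RH to height ≍2/√c₀ moved along the flow — finite-c data = RH-to-height (Chasse/Farmer).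
sources: PlattTrudgian2021 Thm 1 (RH to height 3·10^12), Literature.Barriers.RiemannHypothesis.JensenPolynomials (Farmer2022 §4; Chasse2013), Literature.Barriers.RiemannHypothesis.xiSq_zeros_mem_sector, arXiv:1801.05914 (zero dynamics of heat flows), Literature.NumberTheory.LFunctions.xiSq_zeros_iff_riemannHypothesis
[crux] LOW ZEROS (crux #4): for every c > 0 the zeros of T_c G (a_n = (xiTaylorCoeff n)/(8·n!) =
xiSqCoeff n) inside the disc ‖z‖ < 4/c are real. With #2 this is X (propositional glue: the deciding
theorem `closes` splits on le_or_gt (4/c) ‖z‖). Honest residue: RH-strength as c → 0⁺ (the disc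
exhausts ℂ). For c ≥ c₀ it follows from RH verified to height 2/√c₀ (PlattTrudgian2021: 3·10¹², i.e.
c₀ ≈ 4·10⁻²⁵) transported along the MONOTONE flow (AhfMonotone: non-real zeros are only annihilated
as c grows) plus a certified count; the route's bet for c → 0 is the flow structure (one-sided
semigroup, CZDS monotonicity, threshold) rather than rung-by-rung descent. Rev 2: restated over
xiTaylorCoeff, Iff.rfl-equal to rev 1. [deps: AhfMonotone] [difficulty: open-problem] -/
@[route_item "route-RiemannHypothesis-AngularHeatFlow", crux]
def AhfLowReal : Prop :=
  ∀ c : ℝ, 0 < c → ∀ z : ℂ, (∑' n : ℕ, (Real.exp (-(c * (n : ℝ) ^ 2)) : ℂ) * ((Literature.NumberTheory.LFunctions.xiTaylorCoeff n : ℂ) / (8 * (n.factorial : ℂ))) * z ^ n) = 0 → ‖z‖ < 4 / c → z.im = 0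

-- earlier AhfTailFinite (stmt-RiemannHypothesis-1004, replaced 2026-08-15T16:18:03Z -> stmt-RiemannHypothesis-10534): retired by None — ∀ c : ℝ, 0 < c → ∃ R : ℝ, ∀ z : ℂ, (∑' n : ℕ, (Real.exp (-(c * (n : ℝ) ^ 2)) : ℂ) * Literature.NumberTheory.LFunctions.xiSqCoeff n * z ^ n) = 0 → R ≤ ‖z‖ → z.im = 0
/-- item stmt-RiemannHypothesis-10534 · support · rank 3 · open · by planner
why it might fail: Only false if RH fails. As a proof: the theta comparison must beat the exponentially small size of Θ between consecutive zeros on the negative ray and the alternating cancellation on the positive ray; uniform error control in the window may fail for this engine (then another localisation is needed).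
sources: arXiv:1904.12438 Thm 1.5, KiKimLee2009 (doi:10.1016/j.aim.2009.04.003), Sketch.lean (planner folder): example AhfHighReal → AhfTailFinite
[support] TAIL THEOREM: for every c > 0 there is R with every zero of T_c G (a_n = (xiTaylorCoeff
n)/(8·n!) = xiSqCoeff n) beyond radius R real — per-c finiteness of the non-real zeros, the formal
base case of AhfHighReal (which gives it with R := 4/c) and the analogue of Ki–Kim–Lee's theorem
(H_t has finitely many non-real zeros for each t > 0). Engine: in a window of indices around K the
tapered coefficients log(e^{−cn²}a_n) are quadratic in (n−K) up to o(1) once the taper curvature c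
dominates the intrinsic curvature ≈ 1/K of log a_n, so near |z| ≈ x_K the series is a small
perturbation of the two-sided Jacobi theta Σ_{m∈ℤ} q^{m²} yᵐ (q = e^{−2c}), all of whose zeros are
real negative by the triple product (Mathlib: JacobiTheta); Rouché/Hurwitz transfers reality.
RH-implied (RH → X → this), so unconditionally true iff provable; expected crude radius exp(C/c).
Why it might fail as a proof: the theta comparison must beat the exponentially small size of Θ
between consecutive zeros on the negative ray. Rev 2: restated over xiTaylorCoeff, Iff.rfl-equal to
rev 1. [difficulty: L] -/
@[route_item "route-RiemannHypothesis-AngularHeatFlow", crux]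
def AhfTailFinite : Prop :=
  ∀ c : ℝ, 0 < c → ∃ R : ℝ, ∀ z : ℂ, (∑' n : ℕ, (Real.exp (-(c * (n : ℝ) ^ 2)) : ℂ) * ((Literature.NumberTheory.LFunctions.xiTaylorCoeff n : ℂ) / (8 * (n.factorial : ℂ))) * z ^ n) = 0 → R ≤ ‖z‖ → z.im = 0

-- earlier AhfRungZero (stmt-RiemannHypothesis-1006, replaced 2026-08-15T16:18:03Z -> stmt-RiemannHypothesis-10535): retired by None — ∀ c : ℝ, Real.log 2 ≤ c → ∀ z : ℂ, (∑' n : ℕ, (Real.exp (-(c * (n : ℝ) ^ 2)) : ℂ) * Literature.NumberTheory.LFunctions.xiSqCoeff n * z ^ n) = 0 → z.im = 0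
/-- item stmt-RiemannHypothesis-10535 · support · rank 9 · open · by planner
sources: Hutchinson 1923 TAMS 25, CsordasNorfolkVarga1986 (Turán inequalities), Literature.NumberTheory.LFunctions.isMultiplyPositiveSeq_xi_fortyNine, Literature.Analysis.Complex.HutchinsonMultiplier, doi:10.1007/bf03321047
[support] RUNG ZERO (provable now): for c ≥ log 2, T_c G (a_n = (xiTaylorCoeff n)/(8·n!) = xiSqCoeff
n) has only real zeros, i.e. Λ_× ≤ log 2 unconditionally. Proof: b_n := e^{−cn²}a_n has
b_n²/(b_{n−1}b_{n+1}) = e^{2c}·a_n²/(a_{n−1}a_{n+1}) = e^{2c}·((n+1)/n)·γ(n)²/(γ(n−1)γ(n+1)) ≥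
e^{2c} ≥ 4 by the Csordas–Norfolk–Varga Turán inequalities γ(n)² ≥ γ(n−1)γ(n+1) (PF₂ of the GORZ
coefficients; in tree via Katkova: isMultiplyPositiveSeq_xi_fortyNine / katkova_rh_iff_pf machinery)
and Hutchinson's theorem (TAMS 25 (1923): b_n² ≥ 4b_{n−1}b_{n+1} ∀n ≥ 1 ⇒ only real zeros; cf.
Literature/Computability/AlgebraicComplexity/TavenasHutchinsonFamily and
Literature.Analysis.Complex.HutchinsonMultiplier). Sharper expected: c ≥ ½ log q_∞ = 0.587 via
Katkova–Lobova–Vishnyakova 2003 if their q_∞-criterion applies. Rev 2: restated over xiTaylorCoeff,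
Iff.rfl-equal to rev 1. [difficulty: provable-now] -/
@[route_item "route-RiemannHypothesis-AngularHeatFlow", crux]
def AhfRungZero : Prop :=
  ∀ c : ℝ, Real.log 2 ≤ c → ∀ z : ℂ, (∑' n : ℕ, (Real.exp (-(c * (n : ℝ) ^ 2)) : ℂ) * ((Literature.NumberTheory.LFunctions.xiTaylorCoeff n : ℂ) / (8 * (n.factorial : ℂ))) * z ^ n) = 0 → z.im = 0

-- earlier AhfMonotone (stmt-RiemannHypothesis-1007, replaced 2026-08-15T16:18:03Z -> stmt-RiemannHypothesis-10536): retired by None — ∀ c c' : ℝ, 0 ≤ c → c ≤ c' → (∀ z : ℂ, (∑' n : ℕ, (Real.exp (-(c * (n : ℝ) ^ 2)) : ℂ) * Literature.NumberTheory.LFunctions.xiSqCoeff n * z ^ n) = 0 → z.im = 0) → (∀ z : ℂ, (∑' n : ℕ, (Real.exp (-(c' * (n : ℝ) ^ 2)) : ℂ) * Literature.NumberTheory.LFunctions.xiSqCoeff n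
/-- item stmt-RiemannHypothesis-10536 · support · rank 9 · open · by planner
sources: Pólya–Schur 1914, Craven–Csordas 1995 (CZDS), Literature.Analysis.Complex.PolyaSchur
[support] MONOTONICITY (known theorem instance): if T_c G (a_n = (xiTaylorCoeff n)/(8·n!) =
xiSqCoeff n) has only real zeros and 0 ≤ c ≤ c′ then so does T_{c′} G. T_{c′} = T_{c′−c} ∘ T_c and
{e^{−(c′−c)n²}} is a multiplier sequence of the first kind (Laguerre: φ(x) = e^{−(c′−c)x²} ∈ L-P
with no positive zeros ⇒ {φ(n)} is a multiplier (indeed complex-zero-decreasing, Craven–Csordas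
1995) sequence) mapping L-P I (real entire, order ≤ 1/2 here, negative zeros, positive coefficients)
into itself (Pólya–Schur 1914 composition theorem, transcendental characterisation; in tree
Literature.Analysis.Complex.PolyaSchur). Makes Λ_× a threshold and N(c) non-increasing. Rev 2:
restated over xiTaylorCoeff, Iff.rfl-equal to rev 1. [difficulty: M] -/
@[route_item "route-RiemannHypothesis-AngularHeatFlow", crux]
def AhfMonotone : Prop :=
  ∀ c c' : ℝ, 0 ≤ c → c ≤ c' → (∀ z : ℂ, (∑' n : ℕ, (Real.exp (-(c * (n : ℝ) ^ 2)) : ℂ) * ((Literature.NumberTheory.LFunctions.xiTaylorCoeff n : ℂ) / (8 * (n.factorial : ℂ))) * z ^ n) = 0 → z.im = 0) → (∀ z : ℂ, (∑' n : ℕ, (Real.exp (-(c' * (n : ℝ) ^ 2)) : ℂ) * ((Literature.NumberTheory.LFunctions.xiTaylorCoeff n : ℂ) / (8 * (n.factorial : ℂ))) * z ^ n) = 0 → z.im = 0)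

-- earlier AhfConverse (stmt-RiemannHypothesis-1008, replaced 2026-08-15T16:18:03Z -> stmt-RiemannHypothesis-10537): retired by None — Summit.RiemannHypothesis → ∀ c : ℝ, 0 < c → ∀ z : ℂ, (∑' n : ℕ, (Real.exp (-(c * (n : ℝ) ^ 2)) : ℂ) * Literature.NumberTheory.LFunctions.xiSqCoeff n * z ^ n) = 0 → z.im = 0
/-- item stmt-RiemannHypothesis-10537 · support · rank 9 · open · by planner
sources: Literature.NumberTheory.LFunctions.xiSq_zeros_iff_riemannHypothesis, Literature.NumberTheory.LFunctions.isEntireOfOrderLtOne_xiSq, Literature.Analysis.Complex.PolyaSchur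
[support] CALIBRATION: RH → X (X = AhfThesis by name). Under RH, G = xiSq ∈ L-P I (order 1/2 < 1,
zeros (ρ−1/2)² = −γ² real negative, G(0) = ξ(1/2) > 0: xiSq_zeros_iff_riemannHypothesis,
isEntireOfOrderLtOne_xiSq, in tree), and the Gaussian multiplier sequence {e^{−cn²}} preserves L-P I
(Pólya–Schur/Laguerre, as in AhfMonotone). Shows X is exactly RH-strength (no Conrey–Li-type
overshoot). Rev 2: stated by item name; Iff.rfl-equal to rev 1. [difficulty: M] -/
@[route_item "route-RiemannHypothesis-AngularHeatFlow", crux]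
def AhfConverse : Prop :=
  Summit.RiemannHypothesis → AhfThesis

-- earlier Assembly (stmt-RiemannHypothesis-1009, replaced 2026-08-15T16:18:03Z -> stmt-RiemannHypothesis-10538): retired by None — (∀ c : ℝ, 0 < c → ∀ z : ℂ, (∑' n : ℕ, (Real.exp (-(c * (n : ℝ) ^ 2)) : ℂ) * Literature.NumberTheory.LFunctions.xiSqCoeff n * z ^ n) = 0 → z.im = 0) → Summit.RiemannHypothesis
/-- item stmt-RiemannHypothesis-10538 · assembly · rank 1 · open · by planner
sources: Literature.Analysis.Complex.Hurwitz, Literature.NumberTheory.LFunctions.xiSq_zeros_iff_riemannHypothesis, Literature.NumberTheory.LFunctions.xiTaylorCoeff_pos_holds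
[assembly] ASSEMBLY X → RH (provable now; X = AhfThesis by name): as c → 0⁺, T_c G → G locally
uniformly on ℂ (termwise domination by Σ a_n|z|ⁿ < ∞: a_n = (xiTaylorCoeff n)/(8·n!) = xiSqCoeff n,
hasSum_xiSqCoeff_mul_pow / xiSq_radius_eq_top), G ≢ 0 (xiSq_zero_ne); Hurwitz
(Literature.Analysis.Complex.Hurwitz: hurwitz_eqOn_zero_or_forall_ne_zero) ⇒ every zero of G is a
limit of zeros of T_c G, hence real; a_n > 0 (xiTaylorCoeff_pos_holds) ⇒ G > 0 on [0,∞) so real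
zeros are negative; xiSq_zeros_iff_riemannHypothesis (proved) ⇒ RiemannHypothesis =
Summit.RiemannHypothesis. All inputs are proved theorems of the tree (provers import
Literature.NumberTheory.LFunctions.ZetaLogDerivSeries in the Theorems file; `xiSqCoeff n` unfolds to
the route's spelling by rfl). The route's deciding theorem `closes` is Assembly applied to the
High/Low split. Rev 2: stated by item name; Iff.rfl-equal to rev 1. [difficulty: M] -/
@[route_item "route-RiemannHypothesis-AngularHeatFlow", crux]
def Assembly : Prop :=
  AhfThesis → Summit.RiemannHypothesis

/-! D-0027 §2.1 — DECIDING THEOREM (planner-authored via `route open/edit --closes-file`; by planner-rbadge-RiemannHypothesis-AngularHeatFl-eb57c1f4-g2-0 2026-08-15T16:18:03Z):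
its hypotheses are this route's items and its conclusion the sub-problem Statement (glue_lint), and it elaborates with this file. -/

@[closes "route-RiemannHypothesis-AngularHeatFlow"] theorem closes : AhfThesis → AhfHighReal → AhfLowReal → AhfTailFinite → AhfRungZero → AhfMonotone → AhfConverse → Assembly → _root_.Summit.RiemannHypothesis :=
  fun _h_AhfThesis h_AhfHighReal h_AhfLowReal _h_AhfTailFinite _h_AhfRungZero _h_AhfMonotone _h_AhfConverse h_Assembly =>
    h_Assembly fun c hc z hz => (le_or_gt (4 / c) ‖z‖).elim (h_AhfHighReal c hc z hz) (fun h => h_AhfLowReal c hc z hz h)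

end Summit.RiemannHypothesis.RiemannHypothesis.Theses.AngularHeatFlow
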